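import Summits.HodgeConjecture.HodgeConjecture.Theorems.WeilTypeLadderOnPath
import Literature.AlgebraicGeometry.HodgeTheory.WeilClassesSixfoldsSqrtMinus1Koike
import Literature.AlgebraicGeometry.HodgeTheory.WeilClassesSixfoldsSqrtMinus3Schoen
import HarnessLib

/-!
# WeilTypeLadder · the `d = 1` slice of the sixfold rung R1 on a REFEREED floor: Koike 2004 ∧ R1′[d = 1] ⟹ all `ℚ(i)`-sixfolds

b2b cell `hweil` (packet `run/shared/lean/b2b/hodge-weil/`). Prover 2, generation 2. Twin of
`Theorems/WeilTypeLadderSixfoldsSqrtMinus3.lean` (`d = 3`, Schoen 1998). At `K = ℚ(i)` the unrefereed floor F0a has a REFEREED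
substitute: the named fact `Koike2004_weilClasses_algebraic_hyperbolicSixfold_one` (`Literature/…/WeilClassesSixfoldsSqrtMinus1Koike.lean`;
Koike, Canad. Math. Bull. 47 (2004), Cor. 2.1: "The Weil classes are generated by algebraic cycles for Abelian 6-folds of Weil type for
`ℚ(√-1)` with `δ = 1`", every member via Thm. 2.1 + Schoen's specialization argument; `δ = 1` mod `(k^*)²` = split). This file
records: Koike 2004 ∧ R1′|_{d=1} ⟹ Weil classes algebraic on EVERY complex abelian sixfold with `φ ≫ φ = -1` (case split on the
existence of a hyperbolic `K`-symmetrised hyperplane class), and the on-path form. CONDITIONAL on the refereed fact and on the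
open rung R1′; sorry-free; no definition.
-/


-- every declaration of this problem lives in `Summit.HodgeConjecture.HodgeConjecture.…` (summit = sub-problem)
set_option linter.dupNamespace false

noncomputable section

open CategoryTheory

namespace Summit.HodgeConjecture.HodgeConjecture.WeilTypeLadder

open Literature.AlgebraicGeometry Literature.AlgebraicGeometry.Motives
open Literature.AlgebraicGeometry.HodgeTheory
open Literature.AlgebraicTopology.SingularHomology

/-- **The `d = 1` slice of R1′** (`NonsplitSixfolds` at `K = ℚ(i)`), as a standalone `Prop`-free statement:
extracted from R1′ by instantiation. [folklore] -/
theorem nonsplitSixfolds_one (h : NonsplitSixfolds) :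
    ∀ (A : Motives.AbelianVariety ℂ) (φ : A ⟶ A), A.dim = 2 * 3 →
      Motives.IsSmoothProjective (2 * 3) A.X → φ ≫ φ = -((1 : ℕ) • 𝟙 A) →
        (∀ (e : Motives.ProjectiveEmbedding A.X) (a : complexBetti (Motives.projectiveSpace e.n ℂ) 2),
          IsRationalClass a → a ≠ 0 →
            ¬ Motives.IsHyperbolicWeilType A φ 3
              ((((1 : ℕ) : ℂ)) • complexBetti.map e.ι 2 a +
                complexBetti.map φ.hom.hom.hom 2 (complexBetti.map e.ι 2 a))) →
          ∀ c : complexBetti A.X (2 * 3), IsRationalClass c → IsOfHodgeType (2 * 3) A.X (2 * 3) 3 3 c →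
            c ∈ weilClassesOf A φ 3 1 → c ∈ algebraicClasses A.X 3 :=
  h 1 (by norm_num)

/-- **All `ℚ(i)`-sixfolds from Koike 2004 (split, REFEREED) and R1′[d = 1] (non-split, OPEN).** For every complex
abelian sixfold `(A, φ)` with `φ ≫ φ = -1`, every rational `(3,3)` class of `weilClassesOf A φ 3 1` is algebraic, GRANTED
the named fact `Koike2004_weilClasses_algebraic_hyperbolicSixfold_one` and the rung `NonsplitSixfolds`: by cases on
whether some `K`-symmetrised hyperplane class `e^*a + φ^*e^*a` is hyperbolic. The `d = 1` slice of
`weilSixfolds_of_nonsplitSixfolds_of_floor` with Markman's unrefereed fact replaced by Koike's refereed one.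
[cite: Koike2004WeilHodge, Thm. 2.1 and Cor. 2.1] [cite: Markman2025SurveySecant, §11.5 Step 1] -/
theorem weilClasses_sixfold_one_algebraic_of_koike2004_of_nonsplitSixfolds
    (hS : Koike2004_weilClasses_algebraic_hyperbolicSixfold_one) (h : NonsplitSixfolds) :
    ∀ (A : Motives.AbelianVariety ℂ) (φ : A ⟶ A), A.dim = 2 * 3 →
      Motives.IsSmoothProjective (2 * 3) A.X → φ ≫ φ = -((1 : ℕ) • 𝟙 A) →
        ∀ c : complexBetti A.X (2 * 3), IsRationalClass c → IsOfHodgeType (2 * 3) A.X (2 * 3) 3 3 c →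
          c ∈ weilClassesOf A φ 3 1 → c ∈ algebraicClasses A.X 3 := by
  intro A φ hA hX hφ c hc h33 hW
  by_cases hhyp : ∃ (e : Motives.ProjectiveEmbedding A.X) (a : complexBetti (Motives.projectiveSpace e.n ℂ) 2),
      IsRationalClass a ∧ a ≠ 0 ∧
        Motives.IsHyperbolicWeilType A φ 3
          ((((1 : ℕ) : ℂ)) • complexBetti.map e.ι 2 a + complexBetti.map φ.hom.hom.hom 2 (complexBetti.map e.ι 2 a))
  · obtain ⟨e, a, ha, ha0, hh⟩ := hhyp
    exact hS A φ hA hX hφ e a ha ha0 hh c hc h33 hW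
  · push Not at hhyp
    exact nonsplitSixfolds_one h A φ hA hX hφ (fun e a ha ha0 ↦ hhyp e a ha ha0) c hc h33 hW

/-- **Under the Hodge conjecture** the same `d = 1` statement holds with no fact (on-path form; both hypotheses of the
previous theorem are cases of HC: `nonsplitSixfolds_of_hodgeConjecture` and
`Koike2004_weilClasses_algebraic_hyperbolicSixfold_one_of_hodgeConjectureFor`). [cite: Deligne2000, §1] -/
theorem weilClasses_sixfold_one_algebraic_of_hodgeConjecture (h : _root_.HodgeConjecture) :
    ∀ (A : Motives.AbelianVariety ℂ) (φ : A ⟶ A), A.dim = 2 * 3 →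
      Motives.IsSmoothProjective (2 * 3) A.X → φ ≫ φ = -((1 : ℕ) • 𝟙 A) →
        ∀ c : complexBetti A.X (2 * 3), IsRationalClass c → IsOfHodgeType (2 * 3) A.X (2 * 3) 3 3 c →
          c ∈ weilClassesOf A φ 3 1 → c ∈ algebraicClasses A.X 3 :=
  fun _ _ _ hX _ c hc h33 _ ↦ (h hX).2 3 c hc h33

/-- **The floor F0a at `d ∈ {1, 3}` from REFEREED facts only**: the statement of
`Markman2025_weilClasses_algebraic_hyperbolicSixfold` restricted to `K = ℚ(i)` and `K = ℚ(√-3)` follows from Koike 2004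
(`d = 1`) and Schoen 1998 (`d = 3`) — so every consumer of the unrefereed floor fact at these two fields may cite refereed
theorems instead (trust-base bookkeeping for the B2b packet; nothing new mathematically).
[cite: Koike2004WeilHodge, Cor. 2.1] [cite: Schoen1998HodgeWeilAddendum, §§11–13] [cite: Markman2025SecantWeil, §1 p. 3] -/
theorem weilClasses_algebraic_hyperbolicSixfold_one_or_three_of_refereed
    (hK : Koike2004_weilClasses_algebraic_hyperbolicSixfold_one)
    (hS : Schoen1998_weilClasses_algebraic_hyperbolicSixfold_three) :
    ∀ (d : ℕ), (d = 1 ∨ d = 3) → ∀ (A : Motives.AbelianVariety ℂ) (φ : A ⟶ A), A.dim = 2 * 3 →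
      Motives.IsSmoothProjective (2 * 3) A.X → φ ≫ φ = -(d • 𝟙 A) →
        ∀ (e : Motives.ProjectiveEmbedding A.X)
          (a : complexBetti (Motives.projectiveSpace e.n ℂ) 2), IsRationalClass a → a ≠ 0 →
          Motives.IsHyperbolicWeilType A φ 3
            ((d : ℂ) • complexBetti.map e.ι 2 a +
              complexBetti.map φ.hom.hom.hom 2 (complexBetti.map e.ι 2 a)) →
            ∀ c : complexBetti A.X (2 * 3), IsRationalClass c →
              IsOfHodgeType (2 * 3) A.X (2 * 3) 3 3 c → c ∈ weilClassesOf A φ 3 d →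
                c ∈ algebraicClasses A.X 3 := by
  intro d hd
  rcases hd with rfl | rfl
  · exact hK
  · exact hS

end Summit.HodgeConjecture.HodgeConjecture.WeilTypeLadder


end
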